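import Mathlib
import HarnessLib
import Summits.HubbardSuperconductivity.HubbardSuperconductivity.Theorems.KLProgrammeKLRegimeEngineScaleZeroAlphaW
import Summits.HubbardSuperconductivity.HubbardSuperconductivity.Theorems.KLProgrammeKLRegimeSplitFrameExtFnConst

/-!
# KL programme — scale-0 engine: the weighted decay constant `α_w` at a definite cutoff bound `klCutoffX5`

Companion of `…EngineScaleZeroAlphaW`: there `rowSum_scaleZero_gridLabelWt_le` / `colSum_scaleZero_gridLabelWt_le` carry a
hypothesis `hB : ∀ i ≤ 5, ∀ t, ‖iteratedDeriv i salmhoferCutoff t‖ ≤ B` (the space-moment input of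
`spaceMoment_scaleZero_of_frameOK`).  Here that `B` is discharged by a definite constant

* `klCutoffX5 := Classical.choose (exists_norm_iteratedFDeriv_salmhoferCutoff_le_all 5)` (twin of `klCutoffX4` of
  `…FlowPieceJetsStep`), with `one_le_klCutoffX5` and `norm_iteratedDeriv_salmhoferCutoff_le_klCutoffX5`;
* `rowSum_scaleZero_gridLabelWt_le_X5` / `colSum_scaleZero_gridLabelWt_le_X5` — the `B`-free forms of the weighted row / column
  sums of the scale-0 torus covariance against `gridLabelWt` (the `hrow` / `hcol ≤ α_w` inputs of the (E4)₀ assembly and of the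
  vertex-only two-leg moment bounds B₁ / Bᵗ of `…VertexOnlyTwoLegMoments`).

`klCutoffX5` is a CHOICE constant (not a numeral): the smallness `θ_w ≤ 1/2` still needs a door / numeral for it (p4 g9's
(E4-THR) finding); this file only removes the free parameter `B` from the signatures.

One definition (`klCutoffX5`); everything else proved; no named facts, no sorry.  `--supports stmt-HubbardSuperconductivity-20236` (helper).
-/

noncomputable section

namespace Summit.HubbardSuperconductivity.HubbardSuperconductivity.Theorems.EngineV8

set_option linter.dupNamespace false -- summit = problem name (single-conjunct summit), D-0017

open Real Finset Literature.MathematicalPhysics.QuantumLattice Literature.Probability.LatticeModels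
open Summit.HubbardSuperconductivity.HubbardSuperconductivity.Theorems.KLRegimeSplit
open Summit.HubbardSuperconductivity.HubbardSuperconductivity.Theorems.ScaleZeroDecay

variable {L M : ℕ} [NeZero L] [NeZero M] {R : RenConsts} {U β μ : ℝ} {Nsc : ℕ} {K : TrigPolyC4v}

/-! ## §1 A definite order-`≤ 5` cutoff bound and the `B`-free forms -/

/-- **`klCutoffX5`** — a definite real `≥ 1` bounding `‖Dⁱ χ₂‖` for `i ≤ 5` (chosen from `exists_norm_iteratedFDeriv_salmhoferCutoff_le_all 5`;
twin of `klCutoffX4` of `…FlowPieceJetsStep`): the `B` of `spaceMoment_scaleZero_of_frameOK` / `rowSum_scaleZero_gridLabelWt_le`. -/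
def klCutoffX5 : ℝ := Classical.choose (KLRegimeSplit.exists_norm_iteratedFDeriv_salmhoferCutoff_le_all 5)

/-- `1 ≤ klCutoffX5`. -/
theorem one_le_klCutoffX5 : 1 ≤ klCutoffX5 := (Classical.choose_spec (KLRegimeSplit.exists_norm_iteratedFDeriv_salmhoferCutoff_le_all 5)).1

/-- `‖Dⁱ χ₂ t‖ ≤ klCutoffX5` for `i ≤ 5` (one-variable derivatives). -/
theorem norm_iteratedDeriv_salmhoferCutoff_le_klCutoffX5 : ∀ i ≤ 5, ∀ t : ℝ, ‖iteratedDeriv i salmhoferCutoff t‖ ≤ klCutoffX5 := by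
  intro i hi t
  rw [← norm_iteratedFDeriv_eq_norm_iteratedDeriv]
  exact (Classical.choose_spec (KLRegimeSplit.exists_norm_iteratedFDeriv_salmhoferCutoff_le_all 5)).2 i hi t

section AlphaWX5

variable [h4 : NeZero (2 * (2 * M))]

/-- **`hrow ≤ α_w` at the definite cutoff bound `klCutoffX5`** (no `B` hypothesis). -/
theorem rowSum_scaleZero_gridLabelWt_le_X5 (hK : FrameOK R U Nsc μ K) (hR : R.WF) (hU1 : |U| ≤ 1) (hβ : klBetaMin ≤ β)
    (hL : klEngL₃ β U ≤ L) (hM : klEngM₃ β U L ≤ M) (X : GridLeg (GridPoint L (2 * (2 * M)))) :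
    ∑ Y : GridLeg (GridPoint L (2 * (2 * M))),
        ‖((hubbardGridSub L M β (2 * (2 * M))).transpose * hubbardCovAboveCT L M β μ 0 K klE0 * hubbardGridSub L M β (2 * (2 * M))) X Y‖ *
          gridLabelWt L (2 * (2 * M)) β {gridLegPos X, gridLegPos Y} ≤
      (((2 * (2 * M) : ℕ) : ℝ)) / β *
        (klScaleZeroA0 + uvTimeMomentConst klE0 7 32 +
          2 * (uvSpaceMomentConst klE0 1 (uvPieceSq klE0 (uvBaseQ klCutoffX5 klE0 4) (uvBaseQ' klCutoffX5 klE0 4)) +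
            (1 / 4 * Real.sqrt (216 * (1 / klE0 + 1 / 2)) *
                ∑ e : Fin 2 × Fin 2, (uvLinV klE0 (1 + (e.1 : ℕ) + (e.2 : ℕ)) *
                    (klCutoffX5 * ((1 + ((e.1 : ℕ) + (e.2 : ℕ)) + 2).factorial : ℝ) * (4 / klE0) ^ (1 + ((e.1 : ℕ) + (e.2 : ℕ)) + 1)) +
                  uvLinD klE0 (1 + (e.1 : ℕ) + (e.2 : ℕ)) *
                    (klCutoffX5 * ((1 + ((e.1 : ℕ) + (e.2 : ℕ)) + 3).factorial : ℝ) * (4 / klE0) ^ (1 + ((e.1 : ℕ) + (e.2 : ℕ)) + 2)))) *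
              (4608 * (1 + R.Gfr 0 + R.Gfr 1 + R.Gfr 2 + R.Gfr 3) ^ 4 * (((Nsc : ℝ) + 1) * U ^ 2 + 2 * |U|)))) :=
  rowSum_scaleZero_gridLabelWt_le hK hR hU1 hβ hL hM one_le_klCutoffX5 norm_iteratedDeriv_salmhoferCutoff_le_klCutoffX5 X

/-- **`hcol ≤ α_w` at the definite cutoff bound `klCutoffX5`** (no `B` hypothesis). -/
theorem colSum_scaleZero_gridLabelWt_le_X5 (hK : FrameOK R U Nsc μ K) (hR : R.WF) (hU1 : |U| ≤ 1) (hβ : klBetaMin ≤ β)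
    (hL : klEngL₃ β U ≤ L) (hM : klEngM₃ β U L ≤ M) (Y : GridLeg (GridPoint L (2 * (2 * M)))) :
    ∑ X : GridLeg (GridPoint L (2 * (2 * M))),
        ‖((hubbardGridSub L M β (2 * (2 * M))).transpose * hubbardCovAboveCT L M β μ 0 K klE0 * hubbardGridSub L M β (2 * (2 * M))) X Y‖ *
          gridLabelWt L (2 * (2 * M)) β {gridLegPos X, gridLegPos Y} ≤
      (((2 * (2 * M) : ℕ) : ℝ)) / β *
        (klScaleZeroA0 + uvTimeMomentConst klE0 7 32 +
          2 * (uvSpaceMomentConst klE0 1 (uvPieceSq klE0 (uvBaseQ klCutoffX5 klE0 4) (uvBaseQ' klCutoffX5 klE0 4)) +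
            (1 / 4 * Real.sqrt (216 * (1 / klE0 + 1 / 2)) *
                ∑ e : Fin 2 × Fin 2, (uvLinV klE0 (1 + (e.1 : ℕ) + (e.2 : ℕ)) *
                    (klCutoffX5 * ((1 + ((e.1 : ℕ) + (e.2 : ℕ)) + 2).factorial : ℝ) * (4 / klE0) ^ (1 + ((e.1 : ℕ) + (e.2 : ℕ)) + 1)) +
                  uvLinD klE0 (1 + (e.1 : ℕ) + (e.2 : ℕ)) *
                    (klCutoffX5 * ((1 + ((e.1 : ℕ) + (e.2 : ℕ)) + 3).factorial : ℝ) * (4 / klE0) ^ (1 + ((e.1 : ℕ) + (e.2 : ℕ)) + 2)))) *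
              (4608 * (1 + R.Gfr 0 + R.Gfr 1 + R.Gfr 2 + R.Gfr 3) ^ 4 * (((Nsc : ℝ) + 1) * U ^ 2 + 2 * |U|)))) :=
  colSum_scaleZero_gridLabelWt_le hK hR hU1 hβ hL hM one_le_klCutoffX5 norm_iteratedDeriv_salmhoferCutoff_le_klCutoffX5 Y

end AlphaWX5

end Summit.HubbardSuperconductivity.HubbardSuperconductivity.Theorems.EngineV8

end
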